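import Summits.Ventures.HodgeRepro2.T5SU11ImproperEnergyIdentityAll
import Summits.Ventures.HodgeRepro2.T5SU11GroundStateTransform
import Summits.Ventures.HodgeRepro2.T5SU11SphericalXiLog
import Summits.Ventures.HodgeRepro2.T5SU11KernelBracketEdge
import Summits.Ventures.HodgeRepro2.T5SU11ImproperL2Bound

/-!
# The Hardy inequality on the exponentially decaying class, and the spectral gap of the resolvent for every `λ > 1`

For `λ > 1` and a source `g` of the class at a rate `ε > 1`, `u = G^I_λ g`: row 477's Hardy inequality on `[ε₀, R]`,
`∫_{ε₀}^R sinh 2t u² ≤ ∫_{ε₀}^R sinh 2t (u′)² − (H(R) − H(ε₀))` with the bracket `H = sinh 2t · Ξ′ u²/Ξ`, passes to the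
limits `ε₀ → 0⁺` and `R → ∞` — `H → 0` at both ends (`tendsto_hardyBracket_greenSolI_nhdsGT_zero`,
`tendsto_hardyBracket_greenSolI_atTop`: `|sinh 2t Ξ′(t)| = ∫_0^t sinh 2s Ξ ≤ (α + βt) t e^t/2` against
`Ξ ≥ (1/8)(1 + t) e^{−t}` and `u = O(e^{−ε′ t})`, `ε′ > 1`) — giving

**`∫_{(0,∞)} sinh 2t u² ≤ ∫_{(0,∞)} sinh 2t (u′)²`** (`hardy_inequality_class`),

and with the energy identity of row 531, `‖u′‖² + μ ‖u‖² = −⟨g, u⟩`: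

**`⟨g, G^I_λ g⟩ ≤ −(λ − 1)² ‖G^I_λ g‖² ≤ 0` for every `λ > 1`** (`inner_greenSolI_le_neg`, `inner_greenSolI_nonpos_all`)

— the strict spectral gap of row 487 (`(λ − 1)² = 1 + μ`) on the whole class, and the `L²(sinh 2t dt)` bound
**`‖G^I_λ g‖ ≤ ‖g‖/(λ − 1)²`** (`integral_sinh_mul_greenSolI_sq_le_all`, by the pointwise `|g u| ≤ g²/(2κ) + κ u²/2`
with `κ = (λ − 1)²`) with row 478's sharp constant. Nothing is claimed about (N).

Blind lane: Mathlib + the HodgeRepro2 prefix only; no sorry; axioms ⊆ {propext, Classical.choice,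
Quot.sound}.
-/

namespace Summit.Ventures.HodgeRepro2.T5SU11ImproperHardyClass

open Filter Topology MeasureTheory intervalIntegral
open Set (Ioi Ioc Icc Ioo)
open T5SU11Cartan T5SU11SphericalFunction T5SU11SphericalBounds T5SU11SphericalContinuous
  T5SU11SphericalSolutionSpaceAll T5SU11SphericalDecay T5SU11SphericalDecayBracket T5SU11SphericalXiLog
  T5SU11RadialGreenImproper T5SU11RadialGreenImproperOrigin T5SU11RadialGreenImproperDecaySource
  T5SU11RadialGreenImproperStable T5SU11GroundStateTransform T5SU11KernelBracketEdge
  T5SU11ImproperDerivativeIdentity T5SU11ImproperDerivativeBoundsAll T5SU11ImproperEnergyBracketAll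
  T5SU11ImproperEnergyIdentityAll

/-- A limit device: the interval integral of an integrable function bounded near `0⁺` is continuous at the lower
endpoint `0`. -/
theorem tendsto_intervalIntegral_nhdsGT_zero {F : ℝ → ℝ} {R : ℝ} (hR : 0 < R) (hI : IntegrableOn F (Ioc 0 R))
    {B : ℝ} (hB : ∀ᶠ t in 𝓝[>] (0 : ℝ), |F t| ≤ B) :
    Tendsto (fun ε₀ => ∫ t in ε₀..R, F t) (𝓝[>] (0 : ℝ)) (𝓝 (∫ t in (0 : ℝ)..R, F t)) := by
  obtain ⟨δ, hδ, hδB⟩ := mem_nhdsGT_iff_exists_Ioo_subset.mp hB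
  have hδ0 : 0 < δ := hδ
  have hsplit : ∀ ε₀, 0 < ε₀ → ε₀ < R → ∫ t in ε₀..R, F t = (∫ t in (0 : ℝ)..R, F t) - ∫ t in (0 : ℝ)..ε₀, F t := by
    intro ε₀ hε₀ hε₀R
    have hi1 : IntervalIntegrable F volume 0 ε₀ :=
      (intervalIntegrable_iff_integrableOn_Ioc_of_le hε₀.le).mpr (hI.mono_set (Set.Ioc_subset_Ioc_right hε₀R.le))
    have hi2 : IntervalIntegrable F volume ε₀ R :=
      (intervalIntegrable_iff_integrableOn_Ioc_of_le hε₀R.le).mpr (hI.mono_set (Set.Ioc_subset_Ioc_left hε₀.le))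
    rw [← integral_add_adjacent_intervals hi1 hi2]
    ring
  have h2 : Tendsto (fun ε₀ => ∫ t in (0 : ℝ)..ε₀, F t) (𝓝[>] (0 : ℝ)) (𝓝 0) := by
    have hlimB : Tendsto (fun ε₀ : ℝ => B * |ε₀ - 0|) (𝓝[>] (0 : ℝ)) (𝓝 0) := by
      have : Tendsto (fun ε₀ : ℝ => B * |ε₀ - 0|) (𝓝 0) (𝓝 (B * |(0 : ℝ) - 0|)) :=
        (continuous_const.mul ((continuous_id.sub continuous_const).abs)).tendsto 0
      rw [show B * |(0 : ℝ) - 0| = 0 by simp] at this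
      exact this.mono_left nhdsWithin_le_nhds
    refine squeeze_zero_norm' ?_ hlimB
    filter_upwards [Ioo_mem_nhdsGT hδ0] with ε₀ hε₀
    refine intervalIntegral.norm_integral_le_of_norm_le_const fun t ht => ?_
    rw [Set.uIoc_of_le hε₀.1.le] at ht
    rw [Real.norm_eq_abs]
    exact hδB ⟨ht.1, lt_of_le_of_lt ht.2 hε₀.2⟩
  have h := (tendsto_const_nhds (x := ∫ t in (0 : ℝ)..R, F t)).sub h2
  rw [sub_zero] at h
  refine h.congr' ?_
  filter_upwards [Ioo_mem_nhdsGT hR] with ε₀ hε₀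
  exact (hsplit ε₀ hε₀.1 hε₀.2).symm

section measure

variable [MeasurableSpace Circle] [BorelSpace Circle]

/-! ### The bracket `sinh 2t Ξ′` -/

/-- `|sinh 2t · Ξ′(t)| ≤ (α + βt) t e^t/2` for `t ≥ 0`, where `e^t Ξ ≤ α + βt`. -/
theorem abs_sinh_mul_deriv_sph_one_le {α β : ℝ} (hα : 0 ≤ α) (hβ : 0 ≤ β)
    (hΞ : ∀ t, 0 ≤ t → Real.exp t * sph 1 (hyp t) ≤ α + β * t) {t : ℝ} (ht : 0 ≤ t) :
    |Real.sinh (2 * t) * deriv (fun t => sph 1 (hyp t)) t| ≤ (α + β * t) * t * Real.exp t / 2 := by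
  rw [sinh_mul_deriv_sph_hyp_eq 1 t]
  have hI0 : 0 ≤ ∫ u in (0 : ℝ)..t, Real.sinh (2 * u) * sph 1 (hyp u) :=
    intervalIntegral.integral_nonneg ht (fun u hu => sinh_mul_sph_hyp_nonneg 1 hu.1)
  rw [show (1 : ℝ) * (1 - 2) = -1 by norm_num, neg_one_mul, abs_neg, abs_of_nonneg hI0]
  exact integral_sinh_mul_sph_one_le hα hβ hΞ ht

variable {lam : ℝ} (hlam : 1 < lam) {g : ℝ → ℝ} (hg : ContinuousOn g (Ioi 0))
  {M : ℝ} (hM : ∀ s ∈ Ioc (0 : ℝ) 1, |g s| ≤ M) (hM0 : 0 ≤ M)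
  {ε C s₀ : ℝ} (hε : 2 - lam < ε) (hC : ∀ s, s₀ ≤ s → |g s| ≤ C * Real.exp (-ε * s))
  (hε1 : 1 < ε)

include hlam hg hM hM0 hε hC in
/-- **`H(t) = sinh 2t Ξ′ u²/Ξ → 0` as `t → 0⁺`** for `u = G^I_λ g`. -/
theorem tendsto_hardyBracket_greenSolI_nhdsGT_zero :
    Tendsto (hardyBracket (greenSolI (fun t => sph lam (hyp t)) (sphDecay lam) g)) (𝓝[>] 0) (𝓝 0) := by
  have hA := integrableOn_sphDecay_mul_mul_sinh hlam hg hM hM0 hε hC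
  obtain ⟨B, hB⟩ := eventually_abs_greenSolI_le hlam hM hM0 hA
  have hΞ' : Continuous (deriv fun t => sph 1 (hyp t)) :=
    continuous_iff_continuousAt.mpr fun t => (hasDerivAt_deriv_sph_hyp 1 t).continuousAt
  -- the continuous majorant `t ↦ |sinh 2t Ξ′(t)| B²/Ξ(t)` vanishes at `0`
  have hlim : Tendsto (fun t => |Real.sinh (2 * t) * deriv (fun t => sph 1 (hyp t)) t| * B ^ 2 / sph 1 (hyp t))
      (𝓝[>] (0 : ℝ)) (𝓝 0) := by
    have hc : Continuous (fun t => |Real.sinh (2 * t) * deriv (fun t => sph 1 (hyp t)) t| * B ^ 2 / sph 1 (hyp t)) :=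
      (((Real.continuous_sinh.comp (continuous_const.mul continuous_id)).mul hΞ').abs.mul continuous_const).div
        (continuous_sph_hyp 1) (fun t => (sph_hyp_pos 1 t).ne')
    have := hc.tendsto 0
    simp only [mul_zero, Real.sinh_zero, zero_mul, abs_zero, zero_div] at this
    exact this.mono_left nhdsWithin_le_nhds
  refine squeeze_zero_norm' ?_ hlim
  filter_upwards [hB] with t hBt
  unfold hardyBracket
  have hΞ : 0 < sph 1 (hyp t) := sph_hyp_pos 1 t
  rw [Real.norm_eq_abs, abs_div, abs_of_pos hΞ]
  apply div_le_div_of_nonneg_right _ hΞ.le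
  rw [abs_mul, abs_pow]
  exact mul_le_mul_of_nonneg_left (pow_le_pow_left₀ (abs_nonneg _) hBt 2) (abs_nonneg _)

include hlam hg hM hM0 hε hC hε1 in
/-- **`H(t) → 0` as `t → ∞`** for a source of rate `ε > 1`. -/
theorem tendsto_hardyBracket_greenSolI_atTop :
    Tendsto (hardyBracket (greenSolI (fun t => sph lam (hyp t)) (sphDecay lam) g)) atTop (𝓝 0) := by
  have hmin : 1 < min ε lam := lt_min hε1 hlam
  set ε' := (1 + min ε lam) / 2 with hε'
  have hε'1 : 1 < ε' := by rw [hε']; linarith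
  have hε'2 : ε' < min ε lam := by rw [hε']; linarith
  obtain ⟨K, T, hK, hT, hKT⟩ := exists_abs_greenSolI_le_exp hlam hg hM hM0 hε hC hε'2
  obtain ⟨α, β, hα, hβ, hΞle⟩ := exists_exp_mul_sph_one_hyp_le
  have hlim : Tendsto (fun t => 4 * K ^ 2 * (α * Real.exp (-(2 * ε' - 2) * t) + β * (t * Real.exp (-(2 * ε' - 2) * t))))
      atTop (𝓝 0) := by
    have ha : Tendsto (fun t : ℝ => Real.exp (-(2 * ε' - 2) * t)) atTop (𝓝 0) :=
      Real.tendsto_exp_neg_atTop_nhds_zero.comp (tendsto_id.const_mul_atTop (by linarith : 0 < 2 * ε' - 2))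
        |>.congr (fun t => by simp only [Function.comp_def, id]; ring_nf)
    have hb : Tendsto (fun t : ℝ => t * Real.exp (-(2 * ε' - 2) * t)) atTop (𝓝 0) :=
      T5SU11ResolventBoundary.tendsto_mul_exp_neg_mul_atTop (by linarith)
    have := ((ha.const_mul α).add (hb.const_mul β)).const_mul (4 * K ^ 2)
    simpa using this
  refine squeeze_zero_norm' ?_ hlim
  filter_upwards [eventually_ge_atTop (max T 0)] with t ht
  have ht0 : 0 ≤ t := le_trans (le_max_right _ _) ht
  have htT : T ≤ t := le_trans (le_max_left _ _) ht
  unfold hardyBracket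
  have hΞ : 0 < sph 1 (hyp t) := sph_hyp_pos 1 t
  have hΞl : 1 / 8 * (1 + t) * Real.exp (-t) ≤ sph 1 (hyp t) := le_sph_one_hyp ht0
  have hu := hKT t htT
  have hbr := abs_sinh_mul_deriv_sph_one_le hα hβ hΞle ht0
  rw [Real.norm_eq_abs, abs_div, abs_of_pos hΞ, div_le_iff₀ hΞ, abs_mul, abs_pow]
  have hE : 0 < Real.exp (-t) := Real.exp_pos _
  have hexp : Real.exp t * Real.exp (-ε' * t) ^ 2 = Real.exp (-(2 * ε' - 2) * t) * Real.exp (-t) := by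
    rw [sq, ← Real.exp_add, ← Real.exp_add, ← Real.exp_add]; congr 1; ring
  have hE₂ : 0 ≤ Real.exp (-(2 * ε' - 2) * t) := (Real.exp_pos _).le
  have hαβ : 0 ≤ α + β * t := by positivity
  calc |Real.sinh (2 * t) * deriv (fun t => sph 1 (hyp t)) t| * |greenSolI (fun t => sph lam (hyp t)) (sphDecay lam) g t| ^ 2
      ≤ ((α + β * t) * t * Real.exp t / 2) * (K * Real.exp (-ε' * t)) ^ 2 :=
        mul_le_mul hbr (pow_le_pow_left₀ (abs_nonneg _) hu 2) (by positivity) (by positivity)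
    _ = K ^ 2 / 2 * (α + β * t) * t * (Real.exp t * Real.exp (-ε' * t) ^ 2) := by ring
    _ = K ^ 2 / 2 * (α + β * t) * t * (Real.exp (-(2 * ε' - 2) * t) * Real.exp (-t)) := by rw [hexp]
    _ = 4 * K ^ 2 * (α + β * t) * Real.exp (-(2 * ε' - 2) * t) * (t * Real.exp (-t) / 8) := by ring
    _ ≤ 4 * K ^ 2 * (α + β * t) * Real.exp (-(2 * ε' - 2) * t) * (1 / 8 * (1 + t) * Real.exp (-t)) := by
        apply mul_le_mul_of_nonneg_left _ (by positivity)
        have : t * Real.exp (-t) ≤ (1 + t) * Real.exp (-t) := mul_le_mul_of_nonneg_right (by linarith) hE.le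
        linarith
    _ ≤ 4 * K ^ 2 * (α + β * t) * Real.exp (-(2 * ε' - 2) * t) * sph 1 (hyp t) :=
        mul_le_mul_of_nonneg_left hΞl (by positivity)
    _ = 4 * K ^ 2 * (α * Real.exp (-(2 * ε' - 2) * t) + β * (t * Real.exp (-(2 * ε' - 2) * t))) * sph 1 (hyp t) := by
        ring

include hlam hg hM hM0 hε hC hε1 in
/-- **THE HARDY INEQUALITY ON THE CLASS**: `∫_{(0,∞)} sinh 2t (G^I_λ g)² ≤ ∫_{(0,∞)} sinh 2t ((G^I_λ g)′)²` for every
`λ > 1` and a source of rate `ε > 1`. -/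
theorem hardy_inequality_class :
    ∫ t in Ioi 0, Real.sinh (2 * t) * greenSolI (fun t => sph lam (hyp t)) (sphDecay lam) g t ^ 2
      ≤ ∫ t in Ioi 0, Real.sinh (2 * t) * greenSolI' (deriv fun t => sph lam (hyp t)) (sphDecay' lam)
        (fun t => sph lam (hyp t)) (sphDecay lam) g t ^ 2 := by
  set u := greenSolI (fun t => sph lam (hyp t)) (sphDecay lam) g with hu_def
  set u' := greenSolI' (deriv fun t => sph lam (hyp t)) (sphDecay' lam) (fun t => sph lam (hyp t)) (sphDecay lam) g
    with hu'_def
  have hB := integrableOn_sph_mul_mul_sinh_Ioc hg hM hM0 lam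
  have hA := integrableOn_sphDecay_mul_mul_sinh hlam hg hM hM0 hε hC
  have hu : ∀ t, 0 < t → HasDerivAt u (u' t) t :=
    fun t ht => hasDerivAt_greenSolI (hφ_sph lam) (fun _ hs => hasDerivAt_sphDecay hlam hs) hg hB hA ht
  have hcu' : ContinuousOn u' (Ioi 0) :=
    fun t ht => (hasDerivAt_greenSolI' (hφ_sph lam) (hφ'_sph lam) (fun _ hs => hasDerivAt_sphDecay hlam hs)
      (fun _ hs => hasDerivAt_sphDecay' lam hs) hg hB hA ht).continuousAt.continuousWithinAt
  have hI1 := integrableOn_sinh_mul_greenSolI_sq hlam hg hM hM0 hε hC hε1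
  have hI2 := integrableOn_sinh_mul_greenSolI'_sq hlam hg hM hM0 hε hC hε1
  -- bounds near `0` of the two integrands
  obtain ⟨Bu, hBu⟩ := eventually_abs_greenSolI_le hlam hM hM0 hA
  obtain ⟨Bu', hBu'⟩ := eventually_abs_greenSolI'_le_all hlam hg hM hM0 hε hC
  have hF1 : ∀ᶠ t in 𝓝[>] (0 : ℝ), |Real.sinh (2 * t) * u t ^ 2| ≤ Real.sinh 2 * |Bu| ^ 2 := by
    filter_upwards [hBu, Ioo_mem_nhdsGT one_pos] with t hBt ht
    have hsinh : 0 ≤ Real.sinh (2 * t) := Real.sinh_nonneg_iff.mpr (by linarith [ht.1])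
    rw [abs_mul, abs_of_nonneg hsinh, abs_pow]
    exact mul_le_mul (Real.sinh_le_sinh.mpr (by linarith [ht.2]))
      (pow_le_pow_left₀ (abs_nonneg _) (le_trans hBt (le_abs_self _)) 2) (by positivity)
      (Real.sinh_pos_iff.mpr two_pos).le
  have hF2 : ∀ᶠ t in 𝓝[>] (0 : ℝ), |Real.sinh (2 * t) * u' t ^ 2| ≤ Real.sinh 2 * |Bu'| ^ 2 := by
    filter_upwards [hBu', Ioo_mem_nhdsGT one_pos] with t hBt ht
    have hsinh : 0 ≤ Real.sinh (2 * t) := Real.sinh_nonneg_iff.mpr (by linarith [ht.1])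
    rw [abs_mul, abs_of_nonneg hsinh, abs_pow]
    exact mul_le_mul (Real.sinh_le_sinh.mpr (by linarith [ht.2]))
      (pow_le_pow_left₀ (abs_nonneg _) (le_trans hBt (le_abs_self _)) 2) (by positivity)
      (Real.sinh_pos_iff.mpr two_pos).le
  -- for every `R ≥ 1`: `∫_0^R sinh u² ≤ ∫_0^R sinh u′² − H(R)` (the limit `ε₀ → 0⁺` of row 477's inequality)
  have hfin : ∀ R, 1 ≤ R → ∫ t in (0 : ℝ)..R, Real.sinh (2 * t) * u t ^ 2
      ≤ (∫ t in (0 : ℝ)..R, Real.sinh (2 * t) * u' t ^ 2) - hardyBracket u R := by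
    intro R hR
    have hR0 : 0 < R := lt_of_lt_of_le one_pos hR
    have hl1 := tendsto_intervalIntegral_nhdsGT_zero hR0 (hI1.mono_set Set.Ioc_subset_Ioi_self) hF1
    have hl2 := tendsto_intervalIntegral_nhdsGT_zero hR0 (hI2.mono_set Set.Ioc_subset_Ioi_self) hF2
    have hH := tendsto_hardyBracket_greenSolI_nhdsGT_zero hlam hg hM hM0 hε hC
    have hr : Tendsto (fun ε₀ => (∫ t in ε₀..R, Real.sinh (2 * t) * u' t ^ 2) - (hardyBracket u R - hardyBracket u ε₀))
        (𝓝[>] (0 : ℝ)) (𝓝 ((∫ t in (0 : ℝ)..R, Real.sinh (2 * t) * u' t ^ 2) - (hardyBracket u R - 0))) :=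
      hl2.sub (tendsto_const_nhds.sub hH)
    rw [sub_zero] at hr
    refine le_of_tendsto_of_tendsto hl1 hr ?_
    filter_upwards [Ioo_mem_nhdsGT hR0] with ε₀ hε₀
    exact hardy_ineq_interval hu hcu' hε₀.1 hε₀.2.le
  -- `R → ∞`
  have hR1 : Tendsto (fun R => ∫ t in (0 : ℝ)..R, Real.sinh (2 * t) * u t ^ 2) atTop
      (𝓝 (∫ t in Ioi 0, Real.sinh (2 * t) * u t ^ 2)) := intervalIntegral_tendsto_integral_Ioi 0 hI1 tendsto_id
  have hR2 : Tendsto (fun R => (∫ t in (0 : ℝ)..R, Real.sinh (2 * t) * u' t ^ 2) - hardyBracket u R) atTop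
      (𝓝 ((∫ t in Ioi 0, Real.sinh (2 * t) * u' t ^ 2) - 0)) :=
    (intervalIntegral_tendsto_integral_Ioi 0 hI2 tendsto_id).sub
      (tendsto_hardyBracket_greenSolI_atTop hlam hg hM hM0 hε hC hε1)
  rw [sub_zero] at hR2
  refine le_of_tendsto_of_tendsto hR1 hR2 ?_
  filter_upwards [eventually_ge_atTop 1] with R hR
  exact hfin R hR

include hlam hg hM hM0 hε hC hε1 in
/-- **THE SPECTRAL GAP OF THE RESOLVENT ON THE CLASS**: `⟨g, G^I_λ g⟩ ≤ −(λ − 1)² ‖G^I_λ g‖²` for every `λ > 1` and a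
source of rate `ε > 1`. -/
theorem inner_greenSolI_le_neg :
    ∫ t in Ioi 0, Real.sinh (2 * t) * (g t * greenSolI (fun t => sph lam (hyp t)) (sphDecay lam) g t)
      ≤ -((lam - 1) ^ 2 * ∫ t in Ioi 0, Real.sinh (2 * t) * greenSolI (fun t => sph lam (hyp t)) (sphDecay lam) g t ^ 2) := by
  have hE := energy_identity_class hlam hg hM hM0 hε hC hε1
  have hH := hardy_inequality_class hlam hg hM hM0 hε hC hε1
  nlinarith [hE, hH]

include hlam hg hM hM0 hε hC hε1 in
/-- **`⟨g, G^I_λ g⟩ ≤ 0` for every `λ > 1`** on the class. -/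
theorem inner_greenSolI_nonpos_all :
    ∫ t in Ioi 0, Real.sinh (2 * t) * (g t * greenSolI (fun t => sph lam (hyp t)) (sphDecay lam) g t) ≤ 0 := by
  have h := inner_greenSolI_le_neg hlam hg hM hM0 hε hC hε1
  have hB0 : 0 ≤ ∫ t in Ioi 0, Real.sinh (2 * t) * greenSolI (fun t => sph lam (hyp t)) (sphDecay lam) g t ^ 2 := by
    apply setIntegral_nonneg measurableSet_Ioi
    intro t ht
    have ht0 : 0 < t := ht
    exact mul_nonneg (Real.sinh_nonneg_iff.mpr (by linarith)) (sq_nonneg _)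
  nlinarith [sq_nonneg (lam - 1)]

include hlam hg hM hM0 hε hC hε1 in
/-- **THE SHARP `L²` BOUND OF THE RESOLVENT ON THE CLASS**: `∫_{(0,∞)} sinh 2t (G^I_λ g)² ≤ (∫_{(0,∞)} sinh 2t g²)/(λ − 1)⁴`
for every `λ > 1` and a source of rate `ε > 1` — row 478's constant `1/(λ − 1)²`, on the whole class. -/
theorem integral_sinh_mul_greenSolI_sq_le_all :
    ∫ t in Ioi 0, Real.sinh (2 * t) * greenSolI (fun t => sph lam (hyp t)) (sphDecay lam) g t ^ 2
      ≤ (∫ t in Ioi 0, Real.sinh (2 * t) * g t ^ 2) / ((lam - 1) ^ 2) ^ 2 := by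
  set u := greenSolI (fun t => sph lam (hyp t)) (sphDecay lam) g with hu
  set κ := (lam - 1) ^ 2 with hκ
  have hκ0 : 0 < κ := by rw [hκ]; positivity
  have hgap := inner_greenSolI_le_neg hlam hg hM hM0 hε hC hε1
  have hI2 := integrableOn_sinh_mul_greenSolI_sq hlam hg hM hM0 hε hC hε1
  have hI3 := integrableOn_sinh_mul_mul_greenSolI hlam hg hM hM0 hε hC hε1
  have hIg := T5SU11ImproperL2Bound.integrableOn_sinh_mul_sq hg hM hC hε1
  set B := ∫ t in Ioi 0, Real.sinh (2 * t) * u t ^ 2 with hB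
  set G := ∫ t in Ioi 0, Real.sinh (2 * t) * g t ^ 2 with hG
  have hB0 : 0 ≤ B := by
    apply setIntegral_nonneg measurableSet_Ioi
    intro t ht
    have ht0 : 0 < t := ht
    exact mul_nonneg (Real.sinh_nonneg_iff.mpr (by linarith)) (sq_nonneg _)
  -- `|⟨g, u⟩| ≤ G/(2κ) + κ B/2`
  have hcs : |∫ t in Ioi 0, Real.sinh (2 * t) * (g t * u t)| ≤ G / (2 * κ) + κ / 2 * B := by
    have hIdom : IntegrableOn (fun t => Real.sinh (2 * t) * g t ^ 2 / (2 * κ) + κ / 2 * (Real.sinh (2 * t) * u t ^ 2))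
        (Ioi 0) := (hIg.div_const _).add (hI2.const_mul _)
    calc |∫ t in Ioi 0, Real.sinh (2 * t) * (g t * u t)|
        ≤ ∫ t in Ioi 0, |Real.sinh (2 * t) * (g t * u t)| := by
          have := norm_integral_le_integral_norm (μ := volume.restrict (Ioi 0))
            (fun t => Real.sinh (2 * t) * (g t * u t))
          simpa only [Real.norm_eq_abs] using this
      _ ≤ ∫ t in Ioi 0, (Real.sinh (2 * t) * g t ^ 2 / (2 * κ) + κ / 2 * (Real.sinh (2 * t) * u t ^ 2)) := by
          apply setIntegral_mono_on hI3.abs hIdom measurableSet_Ioi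
          intro t ht
          have ht0 : 0 < t := ht
          have hsinh : 0 ≤ Real.sinh (2 * t) := Real.sinh_nonneg_iff.mpr (by linarith)
          rw [abs_mul, abs_of_nonneg hsinh, abs_mul]
          have hamgm : |g t| * |u t| ≤ g t ^ 2 / (2 * κ) + κ / 2 * u t ^ 2 := by
            have hsq := sq_nonneg (|g t| - κ * |u t|)
            have e1 : |g t| ^ 2 = g t ^ 2 := sq_abs _
            have e2 : |u t| ^ 2 = u t ^ 2 := sq_abs _
            have h2' : 2 * κ * (|g t| * |u t|) ≤ g t ^ 2 + κ ^ 2 * u t ^ 2 := by nlinarith [hsq, e1, e2]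
            rw [show g t ^ 2 / (2 * κ) + κ / 2 * u t ^ 2 = (g t ^ 2 + κ ^ 2 * u t ^ 2) / (2 * κ) by field_simp]
            rw [le_div_iff₀ (by positivity)]
            linarith
          calc Real.sinh (2 * t) * (|g t| * |u t|)
              ≤ Real.sinh (2 * t) * (g t ^ 2 / (2 * κ) + κ / 2 * u t ^ 2) := mul_le_mul_of_nonneg_left hamgm hsinh
            _ = Real.sinh (2 * t) * g t ^ 2 / (2 * κ) + κ / 2 * (Real.sinh (2 * t) * u t ^ 2) := by ring
      _ = G / (2 * κ) + κ / 2 * B := by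
          rw [integral_add (hIg.div_const _) (hI2.const_mul _), MeasureTheory.integral_div,
            MeasureTheory.integral_const_mul]
  have hκB : κ * B ≤ |∫ t in Ioi 0, Real.sinh (2 * t) * (g t * u t)| := by
    have := neg_le_abs (∫ t in Ioi 0, Real.sinh (2 * t) * (g t * u t))
    linarith
  have hkey : κ / 2 * B ≤ G / (2 * κ) := by linarith
  rw [le_div_iff₀ (by positivity)]
  have := mul_le_mul_of_nonneg_left hkey (by positivity : 0 ≤ 2 * κ)
  calc B * κ ^ 2 = 2 * κ * (κ / 2 * B) := by ring
    _ ≤ 2 * κ * (G / (2 * κ)) := this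
    _ = G := by field_simp

end measure

end Summit.Ventures.HodgeRepro2.T5SU11ImproperHardyClass
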